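import Literature.MathematicalPhysics.QuantumLattice.FermionSectorMixtureEntropy
import Literature.Computability.AlgebraicComplexity.FixedPointLog
import HarnessLib

/-!
# Kernel checker for the entropy input of a sector-mixture box state: certified arithmetic for
# `S⁻ ≤ H(q) + Σ_s q_s S⁻_s ≤ S(⊕_s q_s ρ_s)` from a type `m` (`q_s = m_s/Q`) and per-sector entropy floors

Topic `Literature/MathematicalPhysics/QuantumLattice` (namespace = path; family `hubbard`). Companion of
`FermionSectorMixtureEntropy.lean` (`le_vonNeumannEntropy_sectorMixture`: `q ≥ 0`, `S⁻_s ≤ S(ρ_s)` for states in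
distinct `(N↑, N↓)` sectors ⇒ `Σ_s (η(q_s) + q_s S⁻_s) ≤ S(Σ_s q_s ρ_s)`) in the style of the C2 sidecar checker
`c2Check` (`TypeClassSidecarReader.lean`): the mixing-entropy arithmetic is done by the KERNEL in first-order `ℕ`/`ℤ` code
(`decide +kernel`) with the certified fixed-point logarithms of `Literature/Computability/AlgebraicComplexity/FixedPointLog.lean`
(`logRatLo`, soundness `logRat_sound_of_inRange`). Written for the seam-dressed cluster certificates (C3) of the Hubbard
`T > 0` family (sr-mbsolver/hubbard-thermal; kernel reader HOME/hubbard-thermal-p2/C3-READER-SPEC.md, Part B): a producer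
ships the type `m_s` (one box state `σ = ⊕_s (m_s/Q) ρ_s`) and certified dyadic floors `S⁻_s = sn_s/2^E ≤ S(ρ_s)`; the
kernel certifies the box entropy input `S⁻ ≤ S(σ)` — only the per-sector floors remain claim-node data.

* §1 rows `C3SRow = (N↑, N↓, m, sn, en, ed)` (`en`, `ed` = range hints for `log(Q/m)`), `termLo`
  (certified lower bound on `2^P·2^E·m·(log(Q/m) + S⁻_s)`), `c3EntropyCheck P K Q E rows SloNum SloDen : Bool`;
* §2 `c3EntropyCheck_sound`: the check implies `SloNum/SloDen ≤ Σ_{rows} (m/Q)·(log(Q/m) + sn/2^E)`;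
* §3 **`le_vonNeumannEntropy_of_c3EntropyCheck`**: with density matrices `ρ_s` supported in the rows' (distinct) sectors
  and `sn_r/2^E ≤ S(ρ_{sec r})`, the check gives `SloNum/SloDen ≤ S(Σ_{rows} (m_r/Q) • ρ_{sec r})`.

Everything is PROVED; definitions (`C3SRow`, `termLo`, `c3EntropyCheck`) are executable bookkeeping with bodies;
no named fact. [cite: NielsenChuang2010, §11.3.5 eq. (11.83) p.517] [cite: CoverThomas2006, Theorem 11.1.3] (types).

## Tree / Mathlib search

REUSED: `logRatLo`, `inRange`, `logRat_sound_of_inRange` (`FixedPointLog`); `le_vonNeumannEntropy_sectorMixture`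
(`FermionSectorMixtureEntropy`); pattern of `c2Check`/`c2Check_sound` (`TypeClassSidecarReader`, whose list lemmas are private
and are re-derived here). `lean search 'EntropyCheck|c3Entropy'`: nothing (2026-08-27).
-/

noncomputable section

namespace Literature.MathematicalPhysics.QuantumLattice

open Matrix Finset HubbardWave0 Literature.InformationTheory.Entropy
open Literature.Computability.AlgebraicComplexity.FixedPoint
open scoped ComplexOrder BigOperators

/-! ### §1 Rows and the checker -/

/-- One row of the entropy part of a C3 sidecar: sector `(nu, nd)`, type multiplicity `m` (`q_s = m/Q`), the
per-sector entropy floor numerator `sn` (`S⁻_s = sn/2^E`, `E` common to the sidecar), and range hints `en`, `ed`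
(`2^en ≤ Q ≤ 2^{en+1}`, `2^ed ≤ m ≤ 2^{ed+1}`) for the fixed-point logarithm of `Q/m`. [cite: CoverThomas2006, Theorem 11.1.3] -/
structure C3SRow where
  /-- `N↑` of the sector. -/
  nu : ℕ
  /-- `N↓` of the sector. -/
  nd : ℕ
  /-- multiplicity of the sector in the type. -/
  m : ℕ
  /-- numerator of the entropy floor `S⁻_s = sn/2^E`. -/
  sn : ℕ
  /-- range hint for `Q`. -/
  en : ℕ
  /-- range hint for `m`. -/
  ed : ℕ
deriving DecidableEq

namespace C3SRow

/-- The sector `(N↑, N↓)` of a row. [cite: CoverThomas2006, Theorem 11.1.3] -/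
def sec (r : C3SRow) : ℕ × ℕ := (r.nu, r.nd)

/-- Row sanity: `m = 0`, or both range hints in shape. [cite: CoverThomas2006, Theorem 11.1.3] -/
def ok (Q : ℕ) (r : C3SRow) : Bool :=
  decide (r.m = 0) || (inRange r.en Q && inRange r.ed r.m)

/-- Certified lower bound on `2^P · 2^E · m · (log(Q/m) + sn/2^E)` (`0` if `m = 0`). [cite: CoverThomas2006, Theorem 11.1.3] -/
def termLo (P K Q E : ℕ) (r : C3SRow) : ℤ :=
  if r.m = 0 then 0 else (r.m : ℤ) * (logRatLo P K r.en r.ed Q r.m * 2 ^ E + 2 ^ P * r.sn)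

/-- The real quantity a row contributes: `m · (log(Q/m) + sn/2^E)`. [cite: NielsenChuang2010, §11.3.5 eq. (11.83) p.517] -/
def val (Q E : ℕ) (r : C3SRow) : ℝ := (r.m : ℝ) * (Real.log ((Q : ℝ) / r.m) + (r.sn : ℝ) / 2 ^ E)

/-- **Soundness of the row term**: `termLo ≤ 2^P · 2^E · val`. [cite: CoverThomas2006, Theorem 11.1.3] -/
theorem termLo_le {P K Q E : ℕ} {r : C3SRow} (h : r.ok Q = true) :
    ((r.termLo P K Q E : ℤ) : ℝ) ≤ (2 : ℝ) ^ P * (2 : ℝ) ^ E * r.val Q E := by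
  unfold ok at h
  simp only [Bool.or_eq_true, decide_eq_true_eq, Bool.and_eq_true] at h
  unfold termLo val
  by_cases hm0 : r.m = 0
  · simp [hm0]
  rcases h with h | ⟨hen, hed⟩
  · exact absurd h hm0
  rw [if_neg hm0]
  have hsound := (logRat_sound_of_inRange P K hen hed).1
  have hmr : (0 : ℝ) < r.m := by exact_mod_cast Nat.pos_of_ne_zero hm0
  have h2E : (0 : ℝ) < (2 : ℝ) ^ E := by positivity
  push_cast
  have h1 : (logRatLo P K r.en r.ed Q r.m : ℝ) * (2 : ℝ) ^ E ≤ (2 : ℝ) ^ P * Real.log ((Q : ℝ) / r.m) * (2 : ℝ) ^ E :=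
    mul_le_mul_of_nonneg_right hsound h2E.le
  have h2 : (r.m : ℝ) * ((logRatLo P K r.en r.ed Q r.m : ℝ) * (2 : ℝ) ^ E + (2 : ℝ) ^ P * r.sn) ≤
      (r.m : ℝ) * ((2 : ℝ) ^ P * Real.log ((Q : ℝ) / r.m) * (2 : ℝ) ^ E + (2 : ℝ) ^ P * r.sn) :=
    mul_le_mul_of_nonneg_left (by linarith) hmr.le
  have h3 : (r.m : ℝ) * ((2 : ℝ) ^ P * Real.log ((Q : ℝ) / r.m) * (2 : ℝ) ^ E + (2 : ℝ) ^ P * r.sn) =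
      (2 : ℝ) ^ P * (2 : ℝ) ^ E * ((r.m : ℝ) * (Real.log ((Q : ℝ) / r.m) + (r.sn : ℝ) / 2 ^ E)) := by
    field_simp
  linarith [h3]

end C3SRow

/-- **The entropy checker.** Precision `P` bits, `K` series terms; type size `Q`, floor exponent `E`; claimed entropy
input `SloNum/SloDen`. Checks: distinct sectors, sane rows, `Q, SloDen > 0`, `Σ m = Q`, and the certified arithmetic
`SloNum · 2^P 2^E Q ≤ SloDen · Σ_r termLo(r)`. First-order `ℕ`/`ℤ` code for `decide +kernel`.
[cite: CoverThomas2006, Theorem 11.1.3] -/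
def c3EntropyCheck (P K Q E : ℕ) (rows : List C3SRow) (SloNum : ℤ) (SloDen : ℕ) : Bool :=
  decide ((rows.map C3SRow.sec).Nodup) && rows.all (C3SRow.ok Q) && decide (0 < Q) && decide (0 < SloDen) &&
    decide ((rows.map C3SRow.m).sum = Q) &&
    decide (SloNum * ((2 ^ P * 2 ^ E * Q : ℕ) : ℤ) ≤ (SloDen : ℤ) * (rows.map (C3SRow.termLo P K Q E)).sum)

/-- Kernel smoke test (`P = 30`, `K = 12`): type `(3, 1)` of size `Q = 4` on the sectors `(2,2)`, `(2,1)` with floors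
`S⁻ = 2, 1` (`E = 10`) certifies the entropy input `23/10 ≤ H(3/4, 1/4) + (3/4)·2 + (1/4)·1 = 2.3123…`.
[cite: CoverThomas2006, Theorem 11.1.3] -/
example : c3EntropyCheck 30 12 4 10 [⟨2, 2, 3, 2048, 2, 1⟩, ⟨2, 1, 1, 1024, 2, 0⟩] 23 10 = true := by
  decide +kernel

/-! ### §2 Soundness of the arithmetic -/

/-- Pointwise comparison of list sums. [cite: CoverThomas2006, Theorem 11.1.3] -/
private theorem list_sum_map_le {α : Type*} {l : List α} {f g : α → ℝ} (h : ∀ x ∈ l, f x ≤ g x) :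
    (l.map f).sum ≤ (l.map g).sum := by
  induction l with
  | nil => simp
  | cons a l ih =>
    simp only [List.map_cons, List.sum_cons]
    exact add_le_add (h a (by simp)) (ih fun x hx => h x (by simp [hx]))

/-- `Σ (c · f) = c · Σ f` over a list. [cite: CoverThomas2006, Theorem 11.1.3] -/
private theorem list_sum_map_const_mul {α : Type*} (l : List α) (c : ℝ) (f : α → ℝ) :
    (l.map fun x => c * f x).sum = c * (l.map f).sum := by
  induction l with
  | nil => simp
  | cons a l ih =>
    simp only [List.map_cons, List.sum_cons]
    rw [ih]
    ring

/-- **Soundness of the checker (arithmetic part).** If `c3EntropyCheck P K Q E rows SloNum SloDen = true` then the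
sectors are distinct, `0 < Q`, `Σ m = Q`, and `SloNum/SloDen ≤ (1/Q) · Σ_{rows} m·(log(Q/m) + sn/2^E)`.
[cite: CoverThomas2006, Theorem 11.1.3] -/
theorem c3EntropyCheck_sound {P K Q E : ℕ} {rows : List C3SRow} {SloNum : ℤ} {SloDen : ℕ}
    (h : c3EntropyCheck P K Q E rows SloNum SloDen = true) :
    (rows.map C3SRow.sec).Nodup ∧ 0 < Q ∧ (rows.map C3SRow.m).sum = Q ∧
      (SloNum : ℝ) / SloDen ≤ (rows.map (C3SRow.val Q E)).sum / Q := by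
  unfold c3EntropyCheck at h
  simp only [Bool.and_eq_true, decide_eq_true_eq, List.all_eq_true] at h
  obtain ⟨⟨⟨⟨⟨hnd, hok⟩, hQ⟩, hDen⟩, hsum⟩, harith⟩ := h
  refine ⟨hnd, hQ, hsum, ?_⟩
  have hQr : (0 : ℝ) < Q := by exact_mod_cast hQ
  have hDr : (0 : ℝ) < SloDen := by exact_mod_cast hDen
  have h2 : (0 : ℝ) < (2 : ℝ) ^ P * (2 : ℝ) ^ E := by positivity
  have hterm : (((rows.map (C3SRow.termLo P K Q E)).sum : ℤ) : ℝ) ≤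
      (2 : ℝ) ^ P * (2 : ℝ) ^ E * (rows.map (C3SRow.val Q E)).sum := by
    rw [Int.cast_list_sum, List.map_map, ← list_sum_map_const_mul]
    exact list_sum_map_le fun r hr => by simpa using C3SRow.termLo_le (hok r hr)
  have harith' : (SloNum : ℝ) * ((2 : ℝ) ^ P * (2 : ℝ) ^ E * Q) ≤
      (SloDen : ℝ) * (((rows.map (C3SRow.termLo P K Q E)).sum : ℤ) : ℝ) := by
    have := harith
    exact_mod_cast this
  rw [div_le_div_iff₀ hDr hQr]
  nlinarith [mul_le_mul_of_nonneg_left hterm hDr.le, harith']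

/-! ### §3 From the check to the box entropy -/

/-- The sector set of the rows. [cite: CoverThomas2006, Theorem 11.1.3] -/
def c3Sectors (rows : List C3SRow) : Finset (ℕ × ℕ) := (rows.map C3SRow.sec).toFinset

/-- The type `m : ℕ × ℕ → ℕ` of the rows (`0` off the sector set). [cite: CoverThomas2006, Theorem 11.1.3] -/
def c3Mult (rows : List C3SRow) (s : ℕ × ℕ) : ℕ := ((rows.filter fun r => r.sec = s).map C3SRow.m).sum

/-- The entropy-floor numerator `sn : ℕ × ℕ → ℕ` of the rows (`0` off the sector set).
[cite: NielsenChuang2010, §11.3.5 eq. (11.83) p.517] -/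
def c3FloorNum (rows : List C3SRow) (s : ℕ × ℕ) : ℕ := ((rows.filter fun r => r.sec = s).map C3SRow.sn).sum

/-- With distinct sectors, the rows of the sector of `r ∈ rows` are exactly `[r]`. [cite: CoverThomas2006, Theorem 11.1.3] -/
private theorem filter_sec_eq_singleton {rows : List C3SRow} (hnd : (rows.map C3SRow.sec).Nodup) {r : C3SRow}
    (hr : r ∈ rows) : (rows.filter fun r' => r'.sec = r.sec) = [r] := by
  induction rows with
  | nil => simp at hr
  | cons a l ih =>
    rw [List.map_cons, List.nodup_cons] at hnd
    obtain ⟨ha, hl⟩ := hnd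
    rcases List.mem_cons.1 hr with rfl | hrl
    · rw [List.filter_cons_of_pos (by simp)]
      congr 1
      rw [List.filter_eq_nil_iff]
      intro r' hr' h
      simp only [decide_eq_true_eq] at h
      exact ha (h ▸ List.mem_map.2 ⟨r', hr', rfl⟩)
    · have hne : a.sec ≠ r.sec := fun h => ha (h ▸ List.mem_map.2 ⟨r, hrl, rfl⟩)
      rw [List.filter_cons_of_neg (by simpa using hne)]
      exact ih hl hrl

/-- With distinct sectors, `c3Mult rows (sec r) = m_r`. [cite: CoverThomas2006, Theorem 11.1.3] -/
theorem c3Mult_sec {rows : List C3SRow} (hnd : (rows.map C3SRow.sec).Nodup) {r : C3SRow} (hr : r ∈ rows) :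
    c3Mult rows r.sec = r.m := by
  simp [c3Mult, filter_sec_eq_singleton hnd hr]

/-- With distinct sectors, `c3FloorNum rows (sec r) = sn_r`. [cite: NielsenChuang2010, §11.3.5 eq. (11.83) p.517] -/
theorem c3FloorNum_sec {rows : List C3SRow} (hnd : (rows.map C3SRow.sec).Nodup) {r : C3SRow} (hr : r ∈ rows) :
    c3FloorNum rows r.sec = r.sn := by
  simp [c3FloorNum, filter_sec_eq_singleton hnd hr]

/-- Membership in the sector set. [cite: CoverThomas2006, Theorem 11.1.3] -/
theorem mem_c3Sectors_iff {rows : List C3SRow} {s : ℕ × ℕ} : s ∈ c3Sectors rows ↔ ∃ r ∈ rows, r.sec = s := by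
  simp [c3Sectors]

/-- **Sums over the sector set are list sums over the rows** (distinct sectors).
[cite: CoverThomas2006, Theorem 11.1.3] -/
theorem sum_c3Sectors_eq {M : Type*} [AddCommMonoid M] {rows : List C3SRow} (hnd : (rows.map C3SRow.sec).Nodup)
    (G : ℕ × ℕ → ℕ → ℕ → M) :
    ∑ s ∈ c3Sectors rows, G s (c3Mult rows s) (c3FloorNum rows s) = (rows.map fun r => G r.sec r.m r.sn).sum := by
  unfold c3Sectors
  rw [List.sum_toFinset _ hnd, List.map_map]
  congr 1
  apply List.map_congr_left
  intro r hr
  simp only [Function.comp_apply]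
  rw [c3Mult_sec hnd hr, c3FloorNum_sec hnd hr]

/-- `m · log(Q/m) = Q · η(m/Q)` in the form used below: `(m/Q) · log(Q/m) = η(m/Q)` (`η(t) = −t log t`; both sides
vanish at `m = 0`). [cite: NielsenChuang2010, §11.3.5 eq. (11.83) p.517] -/
theorem div_mul_log_div_eq_negMulLog {Q : ℕ} (hQ : 0 < Q) (m : ℕ) :
    (m : ℝ) / Q * Real.log ((Q : ℝ) / m) = Real.negMulLog ((m : ℝ) / Q) := by
  rcases Nat.eq_zero_or_pos m with hm | hm
  · subst hm
    simp
  · have hQr : (0 : ℝ) < Q := by exact_mod_cast hQ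
    have hmr : (0 : ℝ) < m := by exact_mod_cast hm
    rw [Real.negMulLog, Real.log_div hQr.ne' hmr.ne', Real.log_div hmr.ne' hQr.ne']
    ring

/-- **From the check to the box entropy.** For density matrices `ρ_s` supported in the (distinct) sectors of the rows,
with certified floors `sn_r/2^E ≤ S(ρ_{sec r})`, a passing `c3EntropyCheck` certifies
`SloNum/SloDen ≤ S(Σ_{s ∈ sectors} (m_s/Q) • ρ_s)` — the entropy input `S⁻ ≤ S(σ)` of the box state
`σ = ⊕_s (m_s/Q) ρ_s`. [cite: NielsenChuang2010, §11.3.5 eq. (11.83) p.517] -/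
theorem le_vonNeumannEntropy_of_c3EntropyCheck {Λ : Type*} [LinearOrder Λ] [Fintype Λ]
    {P K Q E : ℕ} {rows : List C3SRow} {SloNum : ℤ} {SloDen : ℕ}
    (h : c3EntropyCheck P K Q E rows SloNum SloDen = true)
    {ρ : ℕ × ℕ → Matrix (Finset (Orb Λ)) (Finset (Orb Λ)) ℂ}
    (hρ : ∀ s ∈ c3Sectors rows, (ρ s).IsHermitian) (htr : ∀ s ∈ c3Sectors rows, (ρ s).trace = 1)
    (hsupp : ∀ s ∈ c3Sectors rows, ∀ i j, ¬ (spinConfig s.1 s.2 i ∧ spinConfig s.1 s.2 j) → ρ s i j = 0)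
    (hS : ∀ r ∈ rows, (r.sn : ℝ) / 2 ^ E ≤ vonNeumannEntropy (ρ r.sec)) :
    (SloNum : ℝ) / SloDen ≤
      vonNeumannEntropy (∑ s ∈ c3Sectors rows, ((((c3Mult rows s : ℝ) / Q : ℝ)) : ℂ) • ρ s) := by
  obtain ⟨hnd, hQ, -, harith⟩ := c3EntropyCheck_sound h
  have hQr : (0 : ℝ) < Q := by exact_mod_cast hQ
  -- the checker form of the sector-mixture entropy lemma
  have hmix := le_vonNeumannEntropy_sectorMixture (Λ := Λ) (c3Sectors rows) hρ htr hsupp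
    (q := fun s => (c3Mult rows s : ℝ) / Q) (Slo := fun s => (c3FloorNum rows s : ℝ) / 2 ^ E)
    (fun s _ => by positivity) (fun s hs => ?_)
  · refine le_trans (le_trans harith (le_of_eq ?_)) hmix
    -- `(Σ_r val r)/Q = Σ_s (η(m_s/Q) + (m_s/Q)·S⁻_s)`
    rw [sum_c3Sectors_eq hnd (fun _ m sn => Real.negMulLog ((m : ℝ) / Q) + (m : ℝ) / Q * ((sn : ℝ) / 2 ^ E)),
      div_eq_iff hQr.ne', ← List.sum_map_mul_right]
    refine congrArg List.sum (List.map_congr_left fun r _ => ?_)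
    rw [C3SRow.val, ← div_mul_log_div_eq_negMulLog hQ]
    field_simp
  · obtain ⟨r, hr, rfl⟩ := mem_c3Sectors_iff.1 hs
    rw [c3FloorNum_sec hnd hr]
    exact hS r hr

end Literature.MathematicalPhysics.QuantumLattice

end
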